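import Summits.BirchSwinnertonDyer.BirchSwinnertonDyer.Theorems.UniversalToricDescentThinCombLineValue
import Summits.BirchSwinnertonDyer.BirchSwinnertonDyer.Theorems.EisensteinPrimesKatzLineFactor
import Summits.BirchSwinnertonDyer.BirchSwinnertonDyer.Theorems.PrintCf2SplitBadTwoGeneratorPairSupply
import Literature.NumberTheory.EllipticCurves.DeShalit1987.KatzMeasureMonomialLinesFrames
import Literature.NumberTheory.EllipticCurves.HeegnerPointsImaginaryQuadraticProofs
import Literature.NumberTheory.EllipticCurves.ToricTwoVariablePAdicLFunction
import HarnessLib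

/-!
# Line `thin_comb` (v5) on the WALL `AdditiveSplitIMCInclusionAtThree` (stmt-BirchSwinnertonDyer-20395) — stub K3b
# `stub_lineRestrictionIsBDP` CLOSED (`--supports stmt-BirchSwinnertonDyer-20395`; cell `pub/bsd-wall`, lead `cruxlead-20395` g3;
# stub plan = planner `bsd-wall-utd-idea` g46's `K3Split-utd-idea-g46.lean`, evidence #47)

**Castella–Wan Cor. 2.12 ("direct comparison of the interpolation properties"), ANY prime `p`, typed.** Let `K` be imaginary
quadratic, `p = 𝔭𝔭′` split, `κ` an ANTICYCLOTOMIC `ℤ_p`-extension with topological generator `γ`, `(κ₁, κ₂; γ₁, γ₂)` a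
generator pair of the `ℤ_p²`-tower and `k : ℕ` with the v2 frame relations `γ₁γ⁻¹ ∈ ker κ`, `γ₂(γ^{p^k})⁻¹ ∈ ker κ` (so the
anticyclotomic line is `T₂ = (1+T₁)^{p^k} − 1`). If `L₂ ∈ R₀⟦T₂⟧⟦T₁⟧` is a toric two-variable frame
(`IsToricTwoVarLFunction ι 𝔭 𝔭′ κ₁ κ₂ γ₁ γ₂ f Ω_K Ω_p L₂`, Castella–Wan Thm. 2.11 shape) and `L(f/K, φ, s)` has an entire
continuation for every everywhere-unramified `φ` of infinity type `(n, −n)`, `n ≥ 1` (Rankin–Selberg, HYPOTHESIS), then the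
central-ray restriction `φ_k(L₂) = L₂(T, (1+T)^{p^k} − 1)` (`TwoVarSubst.spec (p^k) L₂`) is a BDP frame AT THE SAME PERIODS:
`IsBDPLFunction ι 𝔭 κ γ f Ω_K Ω_p (spec (p^k) L₂)`.

Proof (all inputs by name): at `(φ, n, r)` of `IsBDPLFunction`'s range, `r` factors through the pair
(`PrintCf2.GeneratorPairSupply.factorsThroughPair_of_factorsThroughZp_of_isImaginaryQuadratic`); `φ ∘ c = φ⁻¹`
(`KatzLineFrame.galConj_complexConj_eq_inv_of_factorsThroughZp`: avatar through the anticyclotomic `κ`), `c • 𝔭 = 𝔭′`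
(`KatzLineFrame.complexConj_smul_eq_of_ne`) and `φ(ϖ_{c•v}) = φ(ϖ_v)⁻¹` (`KatzLineFrame.valueAtUniformizer_smul_of_galConj_eq_inv`)
give `φ(𝔭′) = φ(𝔭)⁻¹`; the continuation feeds `IsToricTwoVarLFunction.hasValueAt₂_centralRay`, whose point
`(r(γ₁) − 1, r(γ₂) − 1)` is `(x, (1+x)^{p^k} − 1)`, `x = r(γ) − 1` (`LineGeometry.interpolationPoint_mem_line`,
`avatarValueAt_frame_fst`), `‖x‖ < 1` (`ZpExtension.norm_avatarValueAt_sub_one_lt`), and two-variable value compatibility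
along the line (`LineValue.hasValueAt₂_line_iff_hasValueAt_spec`) turns the `HasValueAt₂` into
`(spec (p^k) L₂).HasValueAt x _`. Nothing about BSD is proved here.
-/

set_option linter.dupNamespace false
set_option autoImplicit false

noncomputable section

open scoped Classical

namespace Summit.BirchSwinnertonDyer.BirchSwinnertonDyer.Theorems.UniversalToricDescentThinCombLine

open NumberField IsDedekindDomain Field
open Literature.NumberTheory.EllipticCurves Literature.NumberTheory.GaloisRepresentations
open Summit.BirchSwinnertonDyer.BirchSwinnertonDyer.Theorems.UniversalToricDescentThinComb

/-- **K3b `stub_lineRestrictionIsBDP` of line `thin_comb` v5, closed** (any prime `p`): in a v2 frame of the `ℤ_p²`-tower of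
an imaginary quadratic `K` with `p = 𝔭𝔭′` split and `κ` anticyclotomic, GIVEN the Rankin–Selberg continuation of
`L(f/K, φ, s)` for the everywhere-unramified `φ` of type `(n, −n)`, the central-ray restriction `spec (p^k) L₂` of a toric
two-variable frame `L₂` is a BDP frame at the same periods. [cite: CastellaWan2023, §2.4 Cor. 2.12 (arXiv:1607.02019)]
[cite: Castella2018, Thm. 3.1] [cite: CastellaHsieh2018, §3.3] -/
theorem stub_lineRestrictionIsBDP {p : ℕ} [Fact p.Prime] :
    ∀ (K : Type) [Field K] [NumberField K] (N : ℕ) (f : CuspForm (CongruenceSubgroup.Gamma0 N) 2),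
    IsImaginaryQuadratic K →
    ∀ (κ : ZpExtension K p), κ.IsAnticyclotomic → ∀ (γ : Field.absoluteGaloisGroup K), κ.IsTopGenerator γ →
    ∀ (𝔭 : HeightOneSpectrum (𝓞 K)), ((p : ℕ) : 𝓞 K) ∈ 𝔭.asIdeal →
    ∀ (𝔭' : HeightOneSpectrum (𝓞 K)), ((p : ℕ) : 𝓞 K) ∈ 𝔭'.asIdeal → 𝔭' ≠ 𝔭 →
    ∀ (ι : PadicAlgCl p ≃+* ℂ) (κ₁ κ₂ : ZpExtension K p) (γ₁ γ₂ : Field.absoluteGaloisGroup K) (k : ℕ),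
    ZpExtension.IsTopGeneratorPair κ₁ κ₂ γ₁ γ₂ →
    γ₁ * γ⁻¹ ∈ κ.kerSubgroup → γ₂ * (γ ^ (p ^ k))⁻¹ ∈ κ.kerSubgroup →
    (∀ (φ : HeckeCharacter K) (n : ℕ), 0 < n → (∀ v : HeightOneSpectrum (𝓞 K), φ.IsUnramifiedAt v) →
      φ.HasInfinityType (fun _ ↦ (n : ℤ)) (fun _ ↦ -(n : ℤ)) →
      ∃ L : ℂ → ℂ, Differentiable ℂ L ∧ ∀ s : ℂ, 3 / 2 < s.re → L s = rankinSelbergEulerProductHecke f φ s) →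
    ∀ (ΩK : ℂ) (Ωp : ℂ_[p]) (L₂ : PowerSeries (UnrSeries p)),
      IsToricTwoVarLFunction ι 𝔭 𝔭' κ₁ κ₂ γ₁ γ₂ f ΩK Ωp L₂ →
      IsBDPLFunction ι 𝔭 κ γ f ΩK Ωp (TwoVarSubst.spec (p ^ k) L₂) := by
  intro K _ _ N f hK κ hκ γ hγ 𝔭 h𝔭 𝔭' h𝔭' hne ι κ₁ κ₂ γ₁ γ₂ k hpair hγ₁ hγ₂ hRS ΩK Ωp L₂ hL₂ φ n hn hunr hinf r
    hr hκr
  -- the Rankin–Selberg continuation at `φ`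
  obtain ⟨L, hLd, hLe⟩ := hRS φ n hn hunr hinf
  -- the avatar factors through the pair
  have hpr : FactorsThroughPair κ₁ κ₂ r :=
    PrintCf2.GeneratorPairSupply.factorsThroughPair_of_factorsThroughZp_of_isImaginaryQuadratic hK hpair κ hκr
  -- `φ(𝔭′) = φ(𝔭)⁻¹`: `φ ∘ c = φ⁻¹` (anticyclotomic `κ`), `c • 𝔭 = 𝔭′`
  haveI : IsCMField K := hK.isCMField
  have hφc := KatzLineFrame.galConj_complexConj_eq_inv_of_factorsThroughZp hK ι hκ hr hκr hunr
  have hsmul : IsCMField.complexConj K • 𝔭 = 𝔭' :=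
    KatzLineFrame.complexConj_smul_eq_of_ne hK (Fact.out : p.Prime) h𝔭 h𝔭' hne
  have hψ : heckeValueExtZero φ 𝔭' = (heckeValueExtZero φ 𝔭)⁻¹ := by
    rw [heckeValueExtZero_of_isUnramifiedAt (hunr _), heckeValueExtZero_of_isUnramifiedAt (hunr _), ← hsmul]
    exact KatzLineFrame.valueAtUniformizer_smul_of_galConj_eq_inv hφc hunr 𝔭
  -- the two-variable value on the central ray, read on the line
  have h2 := hL₂.hasValueAt₂_centralRay hn hinf hunr hψ hr hpr hLd hLe
  rw [LineGeometry.interpolationPoint_mem_line hκr hγ₁ hγ₂, LineGeometry.avatarValueAt_frame_fst hκr hγ₁] at h2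
  -- value compatibility along the line
  have hx : ‖avatarValueAt r γ - 1‖ < 1 := ZpExtension.norm_avatarValueAt_sub_one_lt hκr hγ
  exact (LineValue.hasValueAt₂_line_iff_hasValueAt_spec (p ^ k) L₂ hx _).mp h2

end Summit.BirchSwinnertonDyer.BirchSwinnertonDyer.Theorems.UniversalToricDescentThinCombLine

end
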